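import Summits.QuantumFields.QCD.Theses.PauliWegnerSea
import Literature.MathematicalPhysics.QuantumFieldTheory.QCDPhaseQuenchedMomentUpgrade

/-!
# Crux `GluonicCompletion` (stmt-QuantumFields-9152), line `certified-sea-threshold-graft` — stub `stub_quarkLocality`

Almost-sure quark locality: the pair-by-pair phase-quenched fractional-moment bound of clause (ii) upgrades to a
bound on the `e^{δ a_k‖v‖/2}(1+‖v‖)^{-5}`-weighted sum over all endpoints, uniformly in `k` and the volume.

Proof.  Fix `k` in the eventual set of clause (ii), a torus `S ≥ L_k` and a flavour `f`; write
`Z = ∫ |det D| dμ_W` and `X_v = Σ_{a,i,b,j} |D⁻¹((f,0,a,i),(f,v,b,j))|`.  If `Z = 0` the quotient is Lean's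
junk `0`.  If `Z > 0` the quotient is the expectation under the phase-quenched probability measure
`qcdLatticeMeasure` (`qcdPhaseQuenchedExpect_eq_div`, `qcdPhaseQuenchedExpect_eq_integral_qcdLatticeMeasure`),
under which every `X_v` — hence `X_v^s ≤ 1 + X_v` — is integrable
(`integrable_propagatorEntrySum_qcdLatticeMeasure`); so the finite `v`-sum comes out of the integral, each
term is `w_v · FM(v) ≤ w_v · C e^{-δ a_k ‖v‖} = C (1+‖v‖)^{-5} e^{-δ a_k‖v‖/2} ≤ |C| (1+‖v‖)^{-5}`, and
`Σ_{v ∈ ℤ⁴} (1+‖v‖_∞)^{-5} ≤ (Σ_{t ∈ ℤ} (1+|t|)^{-5/4})^4 < ∞` bounds the lattice sum uniformly in the volume.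
-/

noncomputable section

namespace Summit.QuantumFields.QCD.Theorems.CertifiedSeaThresholdGraft

open scoped BigOperators Topology
open MeasureTheory Filter Literature.MathematicalPhysics.QuantumFieldTheory
  Literature.MathematicalPhysics.QuantumLattice Literature.Probability.LatticeModels

/-- `x^s ≤ 1 + x` for `x ≥ 0` and `0 ≤ s ≤ 1` (`x^s ≤ 1` if `x ≤ 1`, `x^s ≤ x` if `x ≥ 1`). [folklore] -/
private theorem rpow_le_one_add {x s : ℝ} (hx : 0 ≤ x) (hs0 : 0 ≤ s) (hs1 : s ≤ 1) :
    x ^ s ≤ 1 + x := by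
  rcases le_total x 1 with h | h
  · exact (Real.rpow_le_one hx h hs0).trans (by linarith)
  · calc x ^ s ≤ x ^ (1 : ℝ) := Real.rpow_le_rpow_of_exponent_le h hs1
      _ = x := Real.rpow_one x
      _ ≤ 1 + x := by linarith

/-- The one-dimensional weight `t ↦ (|t|+1)^{-5/4}` is summable over `ℤ` (a shifted `p`-series with
`p = 5/4 > 1` on each half-line). [folklore] -/
private theorem summable_inv_abs_add_one_rpow :
    Summable fun t : ℤ => ((|(t : ℝ)| + 1) ^ (5 / 4 : ℝ))⁻¹ := by
  have h : Summable fun n : ℕ => (((n : ℝ) + 1) ^ (5 / 4 : ℝ))⁻¹ := by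
    have := (summable_nat_add_iff 1).2 (Real.summable_nat_rpow_inv.2 (by norm_num : (1 : ℝ) < 5 / 4))
    simpa only [Nat.cast_add, Nat.cast_one] using this
  refine Summable.of_nat_of_neg ?_ ?_
  · simpa only [Int.cast_natCast, Nat.abs_cast] using h
  · simpa only [Int.cast_neg, Int.cast_natCast, abs_neg, Nat.abs_cast] using h

/-- **Uniform bound on the lattice sum `Σ_{v ∈ box 4 S} (1+‖v‖_∞)^{-5}`.**  Since `|v_i| ≤ ‖v‖_∞`,
`(1+‖v‖)^{-5} ≤ Π_{i<4} (|v_i|+1)^{-5/4}`, and the sum of the product over the cube factorises into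
`(Σ_{|t| ≤ S} (|t|+1)^{-5/4})^4 ≤ (Σ_{t ∈ ℤ} (|t|+1)^{-5/4})^4`. [folklore] -/
private theorem exists_latticeSum_le :
    ∃ K₀ : ℝ, ∀ S : ℕ, ∑ v ∈ box 4 S, ((1 + ‖v‖) ^ 5)⁻¹ ≤ K₀ := by
  set g : ℤ → ℝ := fun t => ((|(t : ℝ)| + 1) ^ (5 / 4 : ℝ))⁻¹ with hg
  have hg0 : ∀ t, 0 ≤ g t := fun t => by positivity
  have hgs : Summable g := summable_inv_abs_add_one_rpow
  refine ⟨(∑' t, g t) ^ 4, fun S => ?_⟩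
  have h1 : ∀ v : Site 4, ((1 + ‖v‖) ^ 5)⁻¹ ≤ ∏ i : Fin 4, g (v i) := fun v => by
    have hv0 : 0 ≤ ‖v‖ := norm_nonneg v
    have h54 : ((‖v‖ + 1) ^ (5 / 4 : ℝ)) ^ (4 : ℕ) = (1 + ‖v‖) ^ (5 : ℕ) := by
      rw [← Real.rpow_natCast, ← Real.rpow_mul (by positivity), add_comm]
      norm_num
    calc ((1 + ‖v‖) ^ 5)⁻¹ = ∏ _i : Fin 4, ((‖v‖ + 1) ^ (5 / 4 : ℝ))⁻¹ := by
          rw [Finset.prod_const, Finset.card_univ, Fintype.card_fin, inv_pow, h54]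
      _ ≤ ∏ i : Fin 4, g (v i) := Finset.prod_le_prod (fun i _ => by positivity) fun i _ => by
          have hi : |((v i : ℤ) : ℝ)| ≤ ‖v‖ := by
            rw [← Int.norm_eq_abs]; exact norm_le_pi_norm v i
          simp only [hg]
          gcongr
  have h3 : ∑ t ∈ Finset.Icc (-(S : ℤ)) S, g t ≤ ∑' t, g t := hgs.sum_le_tsum _ (fun t _ => hg0 t)
  calc ∑ v ∈ box 4 S, ((1 + ‖v‖) ^ 5)⁻¹ ≤ ∑ v ∈ box 4 S, ∏ i : Fin 4, g (v i) :=
        Finset.sum_le_sum fun v _ => h1 v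
    _ = (∑ t ∈ Finset.Icc (-(S : ℤ)) S, g t) ^ 4 := (Finset.sum_pow' _ _ 4).symm
    _ ≤ (∑' t, g t) ^ 4 := pow_le_pow_left₀ (Finset.sum_nonneg fun t _ => hg0 t) h3 4

/-- **Weighted sum of phase-quenched fractional moments (one torus).**  On the torus of side `T`, let
`X_v ≥ 0` (`v ∈ B`) be observables integrable under the phase-quenched probability measure whenever
`Z = ∫ |det D| dμ_W > 0`, with `∫|det D| X_v^s dμ_W / Z ≤ C e^{-δ α ‖v‖}` (`0 < s < 1`, `δ α ≥ 0`) and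
`Σ_{v ∈ B} (1+‖v‖)^{-5} ≤ K₀`.  Then `∫ |det D| Σ_v e^{δα‖v‖/2} (1+‖v‖)^{-5} X_v^s dμ_W / Z ≤ |C| K₀`:
for `Z = 0` the quotient is `0`; for `Z > 0` pass to `qcdLatticeMeasure`, pull the finite sum out
(`X_v^s ≤ 1 + X_v` is integrable) and bound termwise, `e^{δα‖v‖/2} e^{-δα‖v‖} ≤ 1`. [folklore] -/
private theorem weightedSum_quotient_le {Nf T : ℕ} [NeZero T] (β : ℝ) (mq : Fin Nf → ℝ)
    (B : Finset (Site 4)) (X : Site 4 → GaugeConfig 4 T SU3 → ℝ) {s δ α C K₀ : ℝ}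
    (hs0 : 0 < s) (hs1 : s < 1) (hδα : 0 ≤ δ * α)
    (hK₀ : ∑ v ∈ B, ((1 + ‖v‖) ^ 5)⁻¹ ≤ K₀) (hX0 : ∀ v U, 0 ≤ X v U)
    (hXi : 0 < ∫ U, ‖(diracMatrix U mq).det‖
        ∂(wilsonMeasure (d := 4) (L := T) (fundamentalRep (Fin 3)) β) →
      ∀ v, Integrable (X v) (qcdLatticeMeasure T β mq))
    (hFM : ∀ v ∈ B, (∫ U, ‖(diracMatrix U mq).det‖ * X v U ^ s
        ∂(wilsonMeasure (d := 4) (L := T) (fundamentalRep (Fin 3)) β)) /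
      (∫ U, ‖(diracMatrix U mq).det‖ ∂(wilsonMeasure (d := 4) (L := T) (fundamentalRep (Fin 3)) β)) ≤
        C * Real.exp (-(δ * (α * ‖v‖)))) :
    (∫ U, ‖(diracMatrix U mq).det‖ *
        ∑ v ∈ B, Real.exp (δ * (α * ‖v‖) / 2) * ((1 + ‖v‖) ^ 5)⁻¹ * X v U ^ s
        ∂(wilsonMeasure (d := 4) (L := T) (fundamentalRep (Fin 3)) β)) /
      (∫ U, ‖(diracMatrix U mq).det‖ ∂(wilsonMeasure (d := 4) (L := T) (fundamentalRep (Fin 3)) β)) ≤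
      |C| * K₀ := by
  have hK₀0 : 0 ≤ K₀ := le_trans (Finset.sum_nonneg fun v _ => by positivity) hK₀
  have hZ0 : 0 ≤ ∫ U, ‖(diracMatrix U mq).det‖
      ∂(wilsonMeasure (d := 4) (L := T) (fundamentalRep (Fin 3)) β) :=
    integral_nonneg fun _ => norm_nonneg _
  rcases hZ0.eq_or_lt with hZ | hZ
  · rw [← hZ, div_zero]; positivity
  haveI := isProbabilityMeasure_qcdLatticeMeasure (S := T) β mq hZ
  have key : ∀ φ : GaugeConfig 4 T SU3 → ℝ,
      (∫ U, ‖(diracMatrix U mq).det‖ * φ U ∂(wilsonMeasure (d := 4) (L := T) (fundamentalRep (Fin 3)) β)) /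
        (∫ U, ‖(diracMatrix U mq).det‖ ∂(wilsonMeasure (d := 4) (L := T) (fundamentalRep (Fin 3)) β)) =
      ∫ U, φ U ∂(qcdLatticeMeasure T β mq) := fun φ => by
    rw [← qcdPhaseQuenchedExpect_eq_div, qcdPhaseQuenchedExpect_eq_integral_qcdLatticeMeasure]
  rw [key (fun U => ∑ v ∈ B, Real.exp (δ * (α * ‖v‖) / 2) * ((1 + ‖v‖) ^ 5)⁻¹ * X v U ^ s)]
  have hXs : ∀ v, Integrable (fun U => X v U ^ s) (qcdLatticeMeasure T β mq) := fun v => by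
    refine ((integrable_const (1 : ℝ)).add (hXi hZ v)).mono'
      ((hXi hZ v).aemeasurable.pow_const s).aestronglyMeasurable (Eventually.of_forall fun U => ?_)
    rw [Real.norm_of_nonneg (Real.rpow_nonneg (hX0 v U) s)]
    exact rpow_le_one_add (hX0 v U) hs0.le hs1.le
  rw [integral_finsetSum _ fun v _ => (hXs v).const_mul _]
  have hterm : ∀ v ∈ B,
      ∫ U, Real.exp (δ * (α * ‖v‖) / 2) * ((1 + ‖v‖) ^ 5)⁻¹ * X v U ^ s ∂(qcdLatticeMeasure T β mq) ≤
        |C| * ((1 + ‖v‖) ^ 5)⁻¹ := fun v hv => by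
    rw [integral_const_mul]
    have hFMv := hFM v hv
    rw [key (fun U => X v U ^ s)] at hFMv
    have hw : 0 ≤ Real.exp (δ * (α * ‖v‖) / 2) * ((1 + ‖v‖) ^ 5)⁻¹ := by positivity
    have hx : 0 ≤ δ * (α * ‖v‖) := by
      rw [← mul_assoc]; exact mul_nonneg hδα (norm_nonneg _)
    have hexp : Real.exp (δ * (α * ‖v‖) / 2) * Real.exp (-(δ * (α * ‖v‖))) ≤ 1 := by
      rw [← Real.exp_add, Real.exp_le_one_iff]
      linarith
    calc Real.exp (δ * (α * ‖v‖) / 2) * ((1 + ‖v‖) ^ 5)⁻¹ *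
          ∫ U, X v U ^ s ∂(qcdLatticeMeasure T β mq)
        ≤ Real.exp (δ * (α * ‖v‖) / 2) * ((1 + ‖v‖) ^ 5)⁻¹ * (C * Real.exp (-(δ * (α * ‖v‖)))) :=
          mul_le_mul_of_nonneg_left hFMv hw
      _ = C * ((1 + ‖v‖) ^ 5)⁻¹ * (Real.exp (δ * (α * ‖v‖) / 2) * Real.exp (-(δ * (α * ‖v‖)))) := by
          ring
      _ ≤ |C| * ((1 + ‖v‖) ^ 5)⁻¹ * 1 :=
          mul_le_mul (mul_le_mul_of_nonneg_right (le_abs_self C) (by positivity)) hexp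
            (by positivity) (by positivity)
      _ = |C| * ((1 + ‖v‖) ^ 5)⁻¹ := mul_one _
  calc ∑ v ∈ B, ∫ U, Real.exp (δ * (α * ‖v‖) / 2) * ((1 + ‖v‖) ^ 5)⁻¹ * X v U ^ s
          ∂(qcdLatticeMeasure T β mq)
      ≤ ∑ v ∈ B, |C| * ((1 + ‖v‖) ^ 5)⁻¹ := Finset.sum_le_sum hterm
    _ = |C| * ∑ v ∈ B, ((1 + ‖v‖) ^ 5)⁻¹ := (Finset.mul_sum _ _ _).symm
    _ ≤ |C| * K₀ := mul_le_mul_of_nonneg_left hK₀ (abs_nonneg C)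

/-- **`stub_quarkLocality` — almost-sure quark locality (weighted-sum form of clause (ii)).**  Along a
regularisation `reg` with bare masses `m_crit(k) + a_k m_f/Z_m(k)`, suppose clause (ii) of the crux
hypothesis `H` with its constants exposed: for `0 < s < 1`, `δ > 0`, `C`, eventually in `k`, on every torus
of side `2S+1` with `S ≥ L_k`, for every flavour `f` and endpoint `v ∈ box 4 S`, the phase-quenched
fractional moment `∫|det D| X_v^s dμ_W / ∫|det D| dμ_W` of the colour–spin entry sum
`X_v = Σ_{a,i,b,j} |D⁻¹((f,0,a,i),(f,v,b,j))|` is at most `C e^{-δ a_k ‖v‖}`.  Then the same quotient of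
the WEIGHTED SUM `Σ_{v ∈ box 4 S} e^{δ a_k‖v‖/2} (1+‖v‖)^{-5} X_v^s` is bounded by a constant `C'`
(namely `|C| · sup_S Σ_{v ∈ box 4 S}(1+‖v‖)^{-5}`), eventually in `k`, uniformly in `S ≥ L_k` and `f`.
Proof: `weightedSum_quotient_le` (Tonelli for the finite sum under `qcdLatticeMeasure`, termwise use of
the hypothesis, `e^{δa‖v‖/2} e^{-δa‖v‖} ≤ 1`) and `exists_latticeSum_le`
(`Σ_{ℤ⁴}(1+‖v‖_∞)^{-5} < ∞`). [folklore] -/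
theorem stub_quarkLocality :
    ∀ (Nf : ℕ) (reg : QCDRegularisation Nf) (m : Fin Nf → ℝ) (s δ C : ℝ),
      (0 < s ∧ s < 1 ∧ 0 < δ ∧ ∀ᶠ k in atTop, ∀ S : ℕ, reg.L k ≤ S → ∀ (f : Fin Nf) (v : Literature.Probability.LatticeModels.Site 4), v ∈ box 4 S → (∫ U : GaugeConfig 4 (2 * S + 1) (Matrix.specialUnitaryGroup (Fin 3) ℂ), ‖(diracMatrix U fun fl => reg.mcrit k + reg.a k * m fl / reg.Zm k).det‖ * (∑ a : Fin 3, ∑ i : Fin 4, ∑ b : Fin 3, ∑ j : Fin 4, ‖(diracMatrix U fun fl => reg.mcrit k + reg.a k * m fl / reg.Zm k)⁻¹ (quarkEquiv (f, (Torus.proj (2 * S + 1) 0, a, i))) (quarkEquiv (f, (Torus.proj (2 * S + 1) (v), b, j)))‖) ^ s ∂(wilsonMeasure (fundamentalRep (Fin 3)) (reg.β k))) / (∫ U : GaugeConfig 4 (2 * S + 1) (Matrix.specialUnitaryGroup (Fin 3) ℂ), ‖(diracMatrix U fun fl => reg.mcrit k + reg.a k * m fl / reg.Zm k).det‖ ∂(wilsonMeasure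 (fundamentalRep (Fin 3)) (reg.β k))) ≤ C * Real.exp (-(δ * (reg.a k * ‖v‖)))) →
        ∃ C' : ℝ, ∀ᶠ k in atTop, ∀ S : ℕ, reg.L k ≤ S → ∀ f : Fin Nf,
          (∫ U : GaugeConfig 4 (2 * S + 1) (Matrix.specialUnitaryGroup (Fin 3) ℂ), ‖(diracMatrix U fun fl => reg.mcrit k + reg.a k * m fl / reg.Zm k).det‖ * ∑ v ∈ box 4 S, Real.exp (δ * (reg.a k * ‖v‖) / 2) * ((1 + ‖v‖) ^ 5)⁻¹ * (∑ a : Fin 3, ∑ i : Fin 4, ∑ b : Fin 3, ∑ j : Fin 4, ‖(diracMatrix U fun fl => reg.mcrit k + reg.a k * m fl / reg.Zm k)⁻¹ (quarkEquiv (f, (Torus.proj (2 * S + 1) 0, a, i))) (quarkEquiv (f, (Torus.proj (2 * S + 1) v, b, j)))‖) ^ s ∂(wilsonMeasure (fundamentalRep (Fin 3)) (reg.β k))) / (∫ U : GaugeConfig 4 (2 * S + 1) (Matrix.specialUnitaryGroup (Fin 3) ℂ), ‖(diracMatrix U fun fl => reg.mcrit k + reg.a k * m fl / reg.Zm k).det‖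 ∂(wilsonMeasure (fundamentalRep (Fin 3)) (reg.β k))) ≤ C' := by
  intro Nf reg m s δ C ⟨hs0, hs1, hδ, hH⟩
  obtain ⟨K₀, hK₀⟩ := exists_latticeSum_le
  refine ⟨|C| * K₀, ?_⟩
  filter_upwards [hH] with k hk S hS f
  exact weightedSum_quotient_le (reg.β k) (fun fl => reg.mcrit k + reg.a k * m fl / reg.Zm k) (box 4 S)
    (fun v U => ∑ a : Fin 3, ∑ i : Fin 4, ∑ b : Fin 3, ∑ j : Fin 4,
      ‖(diracMatrix U fun fl => reg.mcrit k + reg.a k * m fl / reg.Zm k)⁻¹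
        (quarkEquiv (f, (Torus.proj (2 * S + 1) 0, a, i))) (quarkEquiv (f, (Torus.proj (2 * S + 1) v, b, j)))‖)
    hs0 hs1 (mul_nonneg hδ.le (reg.a_pos k).le) (hK₀ S) (fun v U => by positivity)
    (fun hZ v => integrable_propagatorEntrySum_qcdLatticeMeasure _ _ hZ f _ _) (hk S hS f)

end Summit.QuantumFields.QCD.Theorems.CertifiedSeaThresholdGraft

end
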